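import Summits.QuantumFields.YangMills.Theorems.BalabanUVNodesN19TiltPathGaussianTwoRuns

/-!
# BalabanUVNodes ∕ node N19 (NE7 bracket) ↔ N14 (NE1′) — THE ANNEALED (TILT-PATH) ROAD FOR TILTED MEANS: `|m_B(s) − m_A(s)| ≤ B·e^{2|s|B}·ϑ·|Tor M|∕γ` for two coercive
# quadratic actions `ϑ`-close in form, and N14's binder `TiltedMeanMatching` INHABITED by King's full-space Gaussian effective measures with NO class cut

Cell `pub-ymgap`, HUMAN RULING D-0062 (Track A), R134 ACCELERATION seat `pub-ymgap-dag-n19-c` (N19 NE7, strategy s1), generation 12, module 19c; route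
`Summits/QuantumFields/YangMills/Theses/BalabanUVNodes.lean` rev 19 (K3⁗ `SpineGivenEndpointR13Sep` = stmt-QuantumFields-20292, `--supports … --as helper`); venue R424
(namespace `Summit.QuantumFields.YangMills.BalabanUVNodes.N19TiltPathTilted`).  ADDITIVE — imports this seat's `…N19TiltPathGaussianTwoRuns` (19a-II, p516244) and through it
`…N19TiltPathGaussian` (19a-I, p515255: `coercive_chord`, `dotProduct_sub_mulVec`, `exp_mul_mem`, ★ `hasDerivAt_integral_exp_neg_pathAction`, `continuousOn_integral_exp_neg_pathAction`,
`integrable_deriv_integrand`, `abs_dotProduct_mulVec_le`, ★ `integral_action_mul_exp_neg_action`), n14-c's `…N18KingModelLargeField` ∕ `…DensTorus` ∕ `…Dens` (`integrable_exp_neg_action`,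
`integrable_dressed`, `dressedZ_full_pos`, `measurable_dotProduct_mulVec`, `effLaplacian_coercive_unif`, `gamma0_pos`, `abs_action_sub_le_torus_of_eq`, `kingTheta_nonneg`,
`summable_kingRadius`), the spine's `NE1p/DressedMGFForm` (`tiltedMean`, `TiltedMeanMatching`) and Mathlib (`integral_tilted`, `integral_withDensity_eq_integral_toReal_smul`,
`HasDerivAt.div`, `Convex.image_sub_le_mul_sub_of_deriv_le`) — all CITED, nothing re-proved; THEOREMS ONLY (0 `def`), modifies nothing.

WHY.  19a∕19b (p515255 · p516244 · `…N19TiltPathKingModel`) ran the annealed road to NE7's `MatchingModConstants` ∕ `Core` and the apex Cauchy statement in King's model with NO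
large-field hypothesis.  N14's binder `TiltedMeanMatching` (the (I)-bracket: source-tilted FIRST MOMENTS of one bounded observable under the two runs) is the other by-name consumer
of a two-run currency.  On the FULL field space the density ratio `e^{−½φ·(Δ_B−Δ_A)φ}` is UNBOUNDED, so no pointwise DENS ∕ SHAPE sandwich exists there and the DENS road
(n19-d `tiltedMeanMatching_of_vacuumDens`, n14-c `tiltedMeanMatching_kingTorus_smallField` ∕ `…_kingTwoClass`) needs a small-field class; the annealed road does not: the tilted mean
along the chord is a quotient of two Feynman–Hellmann-differentiable Gaussian integrals whose derivative is a COVARIANCE `−½Cov_{u,s}(φ·Dφ, W)`, bounded by `B·E_{u,s}|φ·Dφ|` and then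
by equipartition.
* §1 [folklore] `measurable_mul_exp_self`, `abs_mul_exp_self_le` (the weight `W·e^{sW}`, `|·| ≤ B·e^{|s|B}`), ★ `integral_abs_form_mul_le` (`∫ |φ·Dφ|e^{−½φ·Δφ}g ≤ G(ϑ∕γ)|Tor M|∫e^{−½φ·Δφ}`
  for `0 ≤ g ≤ G` — equipartition).
* §2 [folklore ∘ 19a-I] ★★★ **`abs_tiltedRatio_sub_le_of_actionBound`** — `Δ_A`, `Δ_B` `γ`-coercive with `|½φ·Δ_Aφ − ½φ·Δ_Bφ| ≤ ϑ·(φ·φ)∕2`, `|W| ≤ B` measurable, every tilt `s`: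
  `|∫ρ_B W e^{sW}∕∫ρ_B e^{sW} − ∫ρ_A W e^{sW}∕∫ρ_A e^{sW}| ≤ B·e^{2|s|B}·ϑ·|Tor M|∕γ` (chord, FH ×2, quotient rule, `|N| ≤ B·Z`, `|W − m| ≤ 2B`, `Z ≥ e^{−|s|B}∫ρ`, §1, mean value
  inequality on `[0,1]` with interior derivative and endpoint continuity).
* §3 [folklore] `tiltedMean_withDensity_eq_div` — the spine's `tiltedMean W (volume.withDensity ρ) s` IS that ratio (Mathlib `integral_tilted` + `integral_withDensity_eq_integral_toReal_smul`).
* §4 [folklore ∘ §2–§3 + n14-c's King files] ★★ `abs_tiltedMean_sub_le_king` (at `Δ^{(K+1)}`, `Δ^{(K+2)}`: `B·e^{2|s|B}·θ_{K+1}·a·|Tor M|∕γ₀`), ★★★ **`tiltedMeanMatching_kingFullSpace`** (N14's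
  `TiltedMeanMatching l₀ univ ∅ W ν_A W ν_B (K ↦ B·e^{2l₀B}·θ_{K+1}·a·|Tor M|∕γ₀)` with `ν_X = volume.withDensity e^{−½φ·Δ_Xφ}` on the WHOLE field space, one class, `Bad = ∅`;
  hypotheses = the model's data + a bounded measurable `W`), `summable_eta_kingFullSpace` (geometric rate).

HONEST FRAMING.  King's `A = 0` scalar MODEL with periodic boundary conditions and `m² > 0` ([King1986]; template literature) — NOT Bałaban's NE1′ ∕ NE7 for gauge fields (NOT
PRINTED; NODE O ∕ U3 objects), where the action difference is NOT second-moment-small on large fields; nothing of Bałaban's is instantiated or asserted.  Count-neutral; N14 ∕ N18 ∕ N19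
NOT discharged; counts UNMOVED.  Everything is PROVED (0 `sorry`, 0 named facts).  One finite four-torus programme at fixed ε; NOT ℝ⁴, NOT OS, NOT a mass gap, NOT Clay.
-/

noncomputable section

namespace Summit.QuantumFields.YangMills.BalabanUVNodes.N19TiltPathTilted

open MeasureTheory Set Filter Real Matrix Topology
open scoped BigOperators ENNReal
open Literature.MathematicalPhysics.QuantumFieldTheory.Balaban1983to89.B5Prop11Plancherel (Tor)
open Literature.MathematicalPhysics.QuantumFieldTheory.Balaban1983to89.QGQInverse (Coercive)
open Literature.LinearAlgebra.Matrix (dotProduct_self_nonneg_real)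
open YMDAG.N18.KingModelLargeField (integrable_exp_neg_action integrable_dressed dressedZ_full_pos)
open YMDAG.N18.KingModelDensTorus (measurable_dotProduct_mulVec)
open YMDAG.N18.KingModelCauchy (integrand_pos)
open Summit.QuantumFields.YangMills.BalabanUVNodes.N19TiltPathGaussian
open Summit.QuantumFields.BalabanUV.T4Continuum.NE1p.DressedMGFForm (tiltedMean TiltedMeanMatching)

variable {d : ℕ} (M : Fin d → ℕ) [hM : ∀ μ, NeZero (M μ)]

/-! ## §1 The tilted-mean weight `W·e^{sW}` and the absolute form moment under a dressed Gaussian -/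
section Weights

/-- `W·e^{sW}` is measurable. [folklore] -/
theorem measurable_mul_exp_self {Ω : Type*} [MeasurableSpace Ω] {W : Ω → ℝ} (hWm : Measurable W) (s : ℝ) :
    Measurable fun ω => W ω * Real.exp (s * W ω) :=
  hWm.mul (Real.measurable_exp.comp (hWm.const_mul s))

/-- `|W·e^{sW}| ≤ B·e^{|s|B}`. [folklore] -/
theorem abs_mul_exp_self_le {Ω : Type*} {W : Ω → ℝ} {B : ℝ} (hWb : ∀ ω, |W ω| ≤ B) (s : ℝ) (ω : Ω) :
    |W ω * Real.exp (s * W ω)| ≤ B * Real.exp (|s| * B) := by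
  rw [abs_mul, Real.abs_exp]
  exact mul_le_mul (hWb ω) (exp_mul_mem hWb s ω).2 (Real.exp_pos _).le ((abs_nonneg _).trans (hWb ω))

/-- **THE ABSOLUTE FORM MOMENT UNDER A DRESSED GAUSSIAN** [folklore ∘ equipartition]: `Δ` `γ`-coercive, `|φ·Dφ| ≤ ϑφ·φ`, `0 ≤ g ≤ G` measurable:
`∫ |φ·Dφ|·e^{−½φ·Δφ}·g dφ ≤ G·(ϑ∕γ)·|Tor M|·∫ e^{−½φ·Δφ}dφ`. -/
theorem integral_abs_form_mul_le {Δ D : Matrix (Tor M) (Tor M) ℝ} {γ ϑ G : ℝ} (hγ : 0 < γ) (hϑ : 0 ≤ ϑ) (hc : Coercive Δ γ)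
    (hD : ∀ φ : Tor M → ℝ, |φ ⬝ᵥ (D *ᵥ φ)| ≤ ϑ * (φ ⬝ᵥ φ)) {g : (Tor M → ℝ) → ℝ} (hg0 : ∀ φ, 0 ≤ g φ) (hgG : ∀ φ, g φ ≤ G) :
    ∫ φ : Tor M → ℝ, |φ ⬝ᵥ (D *ᵥ φ)| * Real.exp (-(φ ⬝ᵥ (Δ *ᵥ φ) / 2)) * g φ
      ≤ G * (ϑ / γ) * (Fintype.card (Tor M) * ∫ φ : Tor M → ℝ, Real.exp (-(φ ⬝ᵥ (Δ *ᵥ φ) / 2))) := by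
  have hG : 0 ≤ G := (hg0 fun _ => 0).trans (hgG _)
  have hκ : 0 ≤ ∑ x, ∑ y, |Δ x y| := Finset.sum_nonneg fun x _ => Finset.sum_nonneg fun y _ => abs_nonneg _
  have hSρi : Integrable (fun φ : Tor M → ℝ => φ ⬝ᵥ (Δ *ᵥ φ) * Real.exp (-(φ ⬝ᵥ (Δ *ᵥ φ) / 2))) := by
    have h := integrable_deriv_integrand M hγ hκ hc (abs_dotProduct_mulVec_le M Δ) (g := fun _ => (1 : ℝ)) measurable_const
      (fun _ => le_of_eq abs_one)
    refine (h.const_mul (-2)).congr (Eventually.of_forall fun φ => ?_)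
    simp only
    ring
  rw [← integral_action_mul_exp_neg_action M hγ hc, ← integral_const_mul]
  refine integral_mono_of_nonneg (Eventually.of_forall fun φ => mul_nonneg (mul_nonneg (abs_nonneg _) (Real.exp_pos _).le) (hg0 φ))
    (hSρi.const_mul _) (Eventually.of_forall fun φ => ?_)
  have hρ0 : 0 ≤ Real.exp (-(φ ⬝ᵥ (Δ *ᵥ φ) / 2)) := (Real.exp_pos _).le
  have hφS : φ ⬝ᵥ φ ≤ φ ⬝ᵥ (Δ *ᵥ φ) / γ := by
    rw [le_div_iff₀ hγ]
    linarith [hc φ]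
  have hS0 : 0 ≤ φ ⬝ᵥ (Δ *ᵥ φ) := (mul_nonneg hγ.le (dotProduct_self_nonneg_real φ)).trans (hc φ)
  simp only
  calc |φ ⬝ᵥ (D *ᵥ φ)| * Real.exp (-(φ ⬝ᵥ (Δ *ᵥ φ) / 2)) * g φ
      ≤ ϑ * (φ ⬝ᵥ (Δ *ᵥ φ) / γ) * Real.exp (-(φ ⬝ᵥ (Δ *ᵥ φ) / 2)) * G := by
        refine mul_le_mul (mul_le_mul_of_nonneg_right ((hD φ).trans (mul_le_mul_of_nonneg_left hφS hϑ)) hρ0) (hgG φ) (hg0 φ) ?_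
        exact mul_nonneg (mul_nonneg hϑ (div_nonneg hS0 hγ.le)) hρ0
    _ = G * (ϑ / γ) * (φ ⬝ᵥ (Δ *ᵥ φ) * Real.exp (-(φ ⬝ᵥ (Δ *ᵥ φ) / 2))) := by
        field_simp

end Weights

/-! ## §2 The annealed two-run bound for TILTED MEANS -/
section TiltedTwoRuns

/-- **★★★ THE ANNEALED TWO-RUN BOUND FOR TILTED MEANS (GAUSSIAN TILT-PATH ROAD)** [folklore ∘ `N19TiltPathGaussian` §1–§3].  `Δ_A`, `Δ_B` `γ`-coercive (`γ > 0`) with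
`|½φ·Δ_Aφ − ½φ·Δ_Bφ| ≤ ϑ·(φ·φ)∕2`, `W` bounded measurable (`|W| ≤ B`); the `s`-TILTED MEANS of `W` under the two full-space Gaussians,
`m_X(s) = ∫ W e^{sW} e^{−½φ·Δ_Xφ}dφ ∕ ∫ e^{sW} e^{−½φ·Δ_Xφ}dφ`, satisfy `|m_B(s) − m_A(s)| ≤ B·e^{2|s|B}·ϑ·|Tor M|∕γ` for EVERY tilt `s`.
Road: along the chord, `u ↦ m_u(s)` is a quotient of two Feynman–Hellmann-differentiable integrals; its derivative is `−½Cov_{u,s}(φ·Dφ, W)`, bounded by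
`B·E_{u,s}|φ·Dφ| ≤ B e^{2|s|B}·E_{u,0}|φ·Dφ| ≤ B e^{2|s|B}(ϑ∕γ)·|Tor M|` (`integral_abs_form_mul_le`); the mean value inequality on `[0,1]` closes.  On the FULL field space the
density ratio `e^{−½φ·(Δ_B−Δ_A)φ}` is UNBOUNDED, so no pointwise DENS ∕ SHAPE sandwich exists there — the annealed road is the one that reaches N14's binder without a class cut. -/
theorem abs_tiltedRatio_sub_le_of_actionBound {ΔA ΔB : Matrix (Tor M) (Tor M) ℝ} {γ ϑ B : ℝ} (hγ : 0 < γ) (hϑ : 0 ≤ ϑ)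
    (hcA : Coercive ΔA γ) (hcB : Coercive ΔB γ)
    (hAB : ∀ φ : Tor M → ℝ, |φ ⬝ᵥ (ΔA *ᵥ φ) / 2 - φ ⬝ᵥ (ΔB *ᵥ φ) / 2| ≤ ϑ * (φ ⬝ᵥ φ) / 2)
    {W : (Tor M → ℝ) → ℝ} (hWm : Measurable W) (hWb : ∀ φ, |W φ| ≤ B) (s : ℝ) :
    |(∫ φ : Tor M → ℝ, Real.exp (-(φ ⬝ᵥ (ΔB *ᵥ φ) / 2)) * (W φ * Real.exp (s * W φ)))
          / (∫ φ : Tor M → ℝ, Real.exp (-(φ ⬝ᵥ (ΔB *ᵥ φ) / 2)) * Real.exp (s * W φ))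
        - (∫ φ : Tor M → ℝ, Real.exp (-(φ ⬝ᵥ (ΔA *ᵥ φ) / 2)) * (W φ * Real.exp (s * W φ)))
          / (∫ φ : Tor M → ℝ, Real.exp (-(φ ⬝ᵥ (ΔA *ᵥ φ) / 2)) * Real.exp (s * W φ))|
      ≤ B * Real.exp (2 * (|s| * B)) * ϑ * Fintype.card (Tor M) / γ := by
  -- the chord and its data
  set D : Matrix (Tor M) (Tor M) ℝ := ΔB - ΔA with hD
  have hco : ∀ u ∈ Set.Icc (0 : ℝ) 1, Coercive (ΔA + u • D) γ := fun u hu => coercive_chord M hcA hcB hu.1 hu.2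
  have hq : ∀ φ : Tor M → ℝ, |φ ⬝ᵥ (D *ᵥ φ)| ≤ ϑ * (φ ⬝ᵥ φ) := fun φ => by
    rw [hD, dotProduct_sub_mulVec M]
    have h := hAB φ
    rw [← sub_div, abs_div, abs_two] at h
    rw [abs_sub_comm]
    linarith
  have hB : 0 ≤ B := (abs_nonneg _).trans (hWb fun _ => 0)
  -- the two weights
  have hgm : Measurable fun φ : Tor M → ℝ => Real.exp (s * W φ) := Real.measurable_exp.comp (hWm.const_mul s)
  have hgb : ∀ φ : Tor M → ℝ, |Real.exp (s * W φ)| ≤ Real.exp (|s| * B) := fun φ => by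
    rw [Real.abs_exp]
    exact (exp_mul_mem hWb s φ).2
  have hfm : Measurable fun φ : Tor M → ℝ => W φ * Real.exp (s * W φ) := measurable_mul_exp_self hWm s
  have hfb : ∀ φ : Tor M → ℝ, |W φ * Real.exp (s * W φ)| ≤ B * Real.exp (|s| * B) := abs_mul_exp_self_le hWb s
  -- the path objects
  set Z : ℝ → ℝ := fun u => ∫ φ : Tor M → ℝ, Real.exp (-(φ ⬝ᵥ ((ΔA + u • D) *ᵥ φ) / 2)) * Real.exp (s * W φ) with hZ
  set N : ℝ → ℝ := fun u => ∫ φ : Tor M → ℝ, Real.exp (-(φ ⬝ᵥ ((ΔA + u • D) *ᵥ φ) / 2)) * (W φ * Real.exp (s * W φ)) with hN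
  set Zd : ℝ → ℝ := fun u =>
    ∫ φ : Tor M → ℝ, -(φ ⬝ᵥ (D *ᵥ φ) / 2) * Real.exp (-(φ ⬝ᵥ ((ΔA + u • D) *ᵥ φ) / 2)) * Real.exp (s * W φ) with hZd
  set Nd : ℝ → ℝ := fun u =>
    ∫ φ : Tor M → ℝ, -(φ ⬝ᵥ (D *ᵥ φ) / 2) * Real.exp (-(φ ⬝ᵥ ((ΔA + u • D) *ᵥ φ) / 2)) * (W φ * Real.exp (s * W φ)) with hNd
  have hZpos : ∀ u ∈ Set.Icc (0 : ℝ) 1, 0 < Z u := fun u hu => dressedZ_full_pos M hγ (hco u hu) hWm hWb s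
  have hderZ : ∀ u ∈ Set.Ioo (0 : ℝ) 1, HasDerivAt Z (Zd u) u := fun u hu =>
    hasDerivAt_integral_exp_neg_pathAction M hγ hϑ (Ioo_mem_nhds hu.1 hu.2) (fun v hv => hco v (Set.Ioo_subset_Icc_self hv)) hq hgm hgb
  have hderN : ∀ u ∈ Set.Ioo (0 : ℝ) 1, HasDerivAt N (Nd u) u := fun u hu =>
    hasDerivAt_integral_exp_neg_pathAction M hγ hϑ (Ioo_mem_nhds hu.1 hu.2) (fun v hv => hco v (Set.Ioo_subset_Icc_self hv)) hq hfm hfb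
  have hcontZ : ContinuousOn Z (Set.Icc (0 : ℝ) 1) := continuousOn_integral_exp_neg_pathAction M hγ hco hgm hgb
  have hcontN : ContinuousOn N (Set.Icc (0 : ℝ) 1) := continuousOn_integral_exp_neg_pathAction M hγ hco hfm hfb
  -- the path function `m(u) = N u / Z u`
  have hderiv : ∀ u ∈ Set.Ioo (0 : ℝ) 1, HasDerivAt (fun v => N v / Z v) ((Nd u * Z u - N u * Zd u) / Z u ^ 2) u := fun u hu =>
    (hderN u hu).div (hderZ u hu) (hZpos u (Set.Ioo_subset_Icc_self hu)).ne'
  have hcont : ContinuousOn (fun v => N v / Z v) (Set.Icc (0 : ℝ) 1) := hcontN.div hcontZ fun u hu => (hZpos u hu).ne'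
  -- the COVARIANCE bound on the open chord
  set C : ℝ := B * Real.exp (2 * (|s| * B)) * ϑ * Fintype.card (Tor M) / γ with hC
  have hbound : ∀ u ∈ Set.Ioo (0 : ℝ) 1, |(Nd u * Z u - N u * Zd u) / Z u ^ 2| ≤ C := by
    intro u hu
    have hu' : u ∈ Set.Icc (0 : ℝ) 1 := Set.Ioo_subset_Icc_self hu
    have hcu : Coercive (ΔA + u • D) γ := hco u hu'
    have hZu : 0 < Z u := hZpos u hu'
    -- integrability
    have hρi := integrable_exp_neg_action M hγ hcu
    have hρgi := integrable_dressed M hγ hcu hWm hWb s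
    have hρfi : Integrable (fun φ : Tor M → ℝ => Real.exp (-(φ ⬝ᵥ ((ΔA + u • D) *ᵥ φ) / 2)) * (W φ * Real.exp (s * W φ))) :=
      hρi.mul_bdd hfm.aestronglyMeasurable (Eventually.of_forall fun φ => by rw [Real.norm_eq_abs]; exact hfb φ)
    have hqρgi := integrable_deriv_integrand M hγ hϑ hcu hq hgm hgb
    have hqρfi := integrable_deriv_integrand M hγ hϑ hcu hq hfm hfb
    -- the mean `m = N/Z` is bounded by `B`
    set m : ℝ := N u / Z u with hm
    have hNle : |N u| ≤ B * Z u := by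
      rw [hZ, ← integral_const_mul]
      refine (abs_integral_le_integral_abs).trans (integral_mono_of_nonneg (Eventually.of_forall fun φ => abs_nonneg _)
        (hρgi.const_mul B) (Eventually.of_forall fun φ => ?_))
      simp only
      rw [abs_mul, abs_mul, Real.abs_exp, Real.abs_exp]
      have h0 : 0 ≤ Real.exp (-(φ ⬝ᵥ ((ΔA + u • D) *ᵥ φ) / 2)) := (Real.exp_pos _).le
      calc Real.exp (-(φ ⬝ᵥ ((ΔA + u • D) *ᵥ φ) / 2)) * (|W φ| * Real.exp (s * W φ))
          ≤ Real.exp (-(φ ⬝ᵥ ((ΔA + u • D) *ᵥ φ) / 2)) * (B * Real.exp (s * W φ)) :=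
            mul_le_mul_of_nonneg_left (mul_le_mul_of_nonneg_right (hWb φ) (Real.exp_pos _).le) h0
        _ = B * (Real.exp (-(φ ⬝ᵥ ((ΔA + u • D) *ᵥ φ) / 2)) * Real.exp (s * W φ)) := by ring
    have hmB : |m| ≤ B := by
      rw [hm, abs_div, abs_of_pos hZu, div_le_iff₀ hZu]
      exact hNle
    -- `Nd − m·Zd` as ONE integral, and its bound
    have hsplit : Nd u - m * Zd u = ∫ φ : Tor M → ℝ,
        -(φ ⬝ᵥ (D *ᵥ φ) / 2) * Real.exp (-(φ ⬝ᵥ ((ΔA + u • D) *ᵥ φ) / 2)) * Real.exp (s * W φ) * (W φ - m) := by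
      rw [hNd, hZd, ← integral_const_mul, ← integral_sub hqρfi (hqρgi.const_mul m)]
      refine integral_congr_ae (Eventually.of_forall fun φ => ?_)
      simp only
      ring
    have hWm2 : ∀ φ : Tor M → ℝ, |W φ - m| ≤ 2 * B := fun φ => by
      have := abs_sub (W φ) m
      linarith [hWb φ, hmB]
    have habsi : Integrable (fun φ : Tor M → ℝ =>
        |φ ⬝ᵥ (D *ᵥ φ)| * Real.exp (-(φ ⬝ᵥ ((ΔA + u • D) *ᵥ φ) / 2)) * Real.exp (s * W φ)) := by
      refine (hqρgi.norm.const_mul 2).congr (Eventually.of_forall fun φ => ?_)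
      simp only
      rw [Real.norm_eq_abs, abs_mul, abs_mul, abs_neg, abs_div, abs_two, Real.abs_exp, Real.abs_exp]
      ring
    have hNdZd : |Nd u - m * Zd u| ≤ B * (Real.exp (|s| * B) * (ϑ / γ) *
        (Fintype.card (Tor M) * ∫ φ : Tor M → ℝ, Real.exp (-(φ ⬝ᵥ ((ΔA + u • D) *ᵥ φ) / 2)))) := by
      rw [hsplit]
      refine (abs_integral_le_integral_abs).trans ?_
      calc ∫ φ : Tor M → ℝ, |-(φ ⬝ᵥ (D *ᵥ φ) / 2) * Real.exp (-(φ ⬝ᵥ ((ΔA + u • D) *ᵥ φ) / 2)) * Real.exp (s * W φ) * (W φ - m)|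
          ≤ ∫ φ : Tor M → ℝ, B * (|φ ⬝ᵥ (D *ᵥ φ)| * Real.exp (-(φ ⬝ᵥ ((ΔA + u • D) *ᵥ φ) / 2)) * Real.exp (s * W φ)) := by
            refine integral_mono_of_nonneg (Eventually.of_forall fun φ => abs_nonneg _) (habsi.const_mul B)
              (Eventually.of_forall fun φ => ?_)
            simp only
            rw [abs_mul, abs_mul, abs_mul, abs_neg, abs_div, abs_two, Real.abs_exp, Real.abs_exp]
            have h0 : 0 ≤ |φ ⬝ᵥ (D *ᵥ φ)| / 2 * Real.exp (-(φ ⬝ᵥ ((ΔA + u • D) *ᵥ φ) / 2)) * Real.exp (s * W φ) := by positivity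
            calc |φ ⬝ᵥ (D *ᵥ φ)| / 2 * Real.exp (-(φ ⬝ᵥ ((ΔA + u • D) *ᵥ φ) / 2)) * Real.exp (s * W φ) * |W φ - m|
                ≤ |φ ⬝ᵥ (D *ᵥ φ)| / 2 * Real.exp (-(φ ⬝ᵥ ((ΔA + u • D) *ᵥ φ) / 2)) * Real.exp (s * W φ) * (2 * B) :=
                  mul_le_mul_of_nonneg_left (hWm2 φ) h0
              _ = B * (|φ ⬝ᵥ (D *ᵥ φ)| * Real.exp (-(φ ⬝ᵥ ((ΔA + u • D) *ᵥ φ) / 2)) * Real.exp (s * W φ)) := by ring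
        _ = B * ∫ φ : Tor M → ℝ, |φ ⬝ᵥ (D *ᵥ φ)| * Real.exp (-(φ ⬝ᵥ ((ΔA + u • D) *ᵥ φ) / 2)) * Real.exp (s * W φ) :=
            integral_const_mul _ _
        _ ≤ B * (Real.exp (|s| * B) * (ϑ / γ) * (Fintype.card (Tor M) * ∫ φ : Tor M → ℝ, Real.exp (-(φ ⬝ᵥ ((ΔA + u • D) *ᵥ φ) / 2)))) :=
            mul_le_mul_of_nonneg_left (integral_abs_form_mul_le M hγ hϑ hcu hq (fun φ => (Real.exp_pos _).le)
              (fun φ => (exp_mul_mem hWb s φ).2)) hB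
    -- `Z u ≥ e^{−|s|B}·∫ρ`
    have hZlow : Real.exp (-(|s| * B)) * ∫ φ : Tor M → ℝ, Real.exp (-(φ ⬝ᵥ ((ΔA + u • D) *ᵥ φ) / 2)) ≤ Z u := by
      rw [hZ, ← integral_const_mul]
      refine integral_mono (hρi.const_mul _) hρgi fun φ => ?_
      simp only
      rw [mul_comm]
      exact mul_le_mul_of_nonneg_left (exp_mul_mem hWb s φ).1 (Real.exp_pos _).le
    have hI0 : 0 < ∫ φ : Tor M → ℝ, Real.exp (-(φ ⬝ᵥ ((ΔA + u • D) *ᵥ φ) / 2)) := by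
      have := dressedZ_full_pos M hγ hcu hWm hWb 0
      simpa only [zero_mul, Real.exp_zero, mul_one] using this
    -- assemble: |(Nd Z − N Zd)/Z²| = |Nd − m Zd| / Z
    have hrew : (Nd u * Z u - N u * Zd u) / Z u ^ 2 = (Nd u - m * Zd u) / Z u := by
      rw [hm]
      field_simp
    rw [hrew, abs_div, abs_of_pos hZu, div_le_iff₀ hZu]
    refine hNdZd.trans ?_
    -- B e^{|s|B} (ϑ/γ) n ∫ρ ≤ C · Z u, using Z u ≥ e^{−|s|B} ∫ρ and e^{|s|B} e^{|s|B} = e^{2|s|B}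
    have hexp2 : Real.exp (2 * (|s| * B)) = Real.exp (|s| * B) * Real.exp (|s| * B) := by
      rw [← Real.exp_add]; ring_nf
    have hkey : Real.exp (|s| * B) * ∫ φ : Tor M → ℝ, Real.exp (-(φ ⬝ᵥ ((ΔA + u • D) *ᵥ φ) / 2)) ≤ Real.exp (2 * (|s| * B)) * Z u := by
      rw [hexp2, mul_assoc]
      refine mul_le_mul_of_nonneg_left ?_ (Real.exp_pos _).le
      have h := mul_le_mul_of_nonneg_left hZlow (Real.exp_pos (|s| * B)).le
      rw [← mul_assoc, ← Real.exp_add, add_neg_cancel, Real.exp_zero, one_mul] at h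
      exact h
    have hcard : (0 : ℝ) ≤ Fintype.card (Tor M) := Nat.cast_nonneg _
    calc B * (Real.exp (|s| * B) * (ϑ / γ) * (Fintype.card (Tor M) * ∫ φ : Tor M → ℝ, Real.exp (-(φ ⬝ᵥ ((ΔA + u • D) *ᵥ φ) / 2))))
        = B * (ϑ / γ) * Fintype.card (Tor M) * (Real.exp (|s| * B) * ∫ φ : Tor M → ℝ, Real.exp (-(φ ⬝ᵥ ((ΔA + u • D) *ᵥ φ) / 2))) := by ring
      _ ≤ B * (ϑ / γ) * Fintype.card (Tor M) * (Real.exp (2 * (|s| * B)) * Z u) :=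
          mul_le_mul_of_nonneg_left hkey (by positivity)
      _ = C * Z u := by rw [hC]; ring
  -- the mean value inequality on `[0,1]`
  have hdiffOn : DifferentiableOn ℝ (fun v => N v / Z v) (interior (Set.Icc (0 : ℝ) 1)) := by
    rw [interior_Icc]
    exact fun u hu => (hderiv u hu).differentiableAt.differentiableWithinAt
  have hle : ∀ u ∈ interior (Set.Icc (0 : ℝ) 1), deriv (fun v => N v / Z v) u ≤ C := by
    rw [interior_Icc]
    exact fun u hu => by rw [(hderiv u hu).deriv]; exact (abs_le.1 (hbound u hu)).2
  have hge : ∀ u ∈ interior (Set.Icc (0 : ℝ) 1), -C ≤ deriv (fun v => N v / Z v) u := by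
    rw [interior_Icc]
    exact fun u hu => by rw [(hderiv u hu).deriv]; exact (abs_le.1 (hbound u hu)).1
  have h0 : (0 : ℝ) ∈ Set.Icc (0 : ℝ) 1 := ⟨le_rfl, zero_le_one⟩
  have h1 : (1 : ℝ) ∈ Set.Icc (0 : ℝ) 1 := ⟨zero_le_one, le_rfl⟩
  have hup := (convex_Icc (0 : ℝ) 1).image_sub_le_mul_sub_of_deriv_le hcont hdiffOn hle 0 h0 1 h1 zero_le_one
  have hdn := (convex_Icc (0 : ℝ) 1).mul_sub_le_image_sub_of_le_deriv hcont hdiffOn hge 0 h0 1 h1 zero_le_one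
  have hZ1 : Z 1 = ∫ φ : Tor M → ℝ, Real.exp (-(φ ⬝ᵥ (ΔB *ᵥ φ) / 2)) * Real.exp (s * W φ) := by
    simp only [hZ, hD, one_smul, add_sub_cancel]
  have hN1 : N 1 = ∫ φ : Tor M → ℝ, Real.exp (-(φ ⬝ᵥ (ΔB *ᵥ φ) / 2)) * (W φ * Real.exp (s * W φ)) := by
    simp only [hN, hD, one_smul, add_sub_cancel]
  have hZ0 : Z 0 = ∫ φ : Tor M → ℝ, Real.exp (-(φ ⬝ᵥ (ΔA *ᵥ φ) / 2)) * Real.exp (s * W φ) := by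
    simp only [hZ, zero_smul, add_zero]
  have hN0 : N 0 = ∫ φ : Tor M → ℝ, Real.exp (-(φ ⬝ᵥ (ΔA *ᵥ φ) / 2)) * (W φ * Real.exp (s * W φ)) := by
    simp only [hN, zero_smul, add_zero]
  simp only [hZ1, hN1, hZ0, hN0, sub_zero, mul_one] at hup hdn
  rw [abs_le]
  constructor <;> linarith

end TiltedTwoRuns

/-! ## §3 Dictionary: the spine's `tiltedMean` under a Lebesgue density is the ratio of the two dressed integrals -/
section Dictionary

/-- For a measurable density `ρ ≥ 0` on the field space and any observable `W` and tilt `s`: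
`tiltedMean W (volume.withDensity ρ) s = (∫ ρ·W·e^{sW} dφ) ∕ (∫ ρ·e^{sW} dφ)` (Mathlib `integral_tilted` + `integral_withDensity_eq_integral_toReal_smul`). [folklore] -/
theorem tiltedMean_withDensity_eq_div {ρ : (Tor M → ℝ) → ℝ} (hρm : Measurable ρ) (hρ0 : ∀ φ, 0 ≤ ρ φ) (W : (Tor M → ℝ) → ℝ) (s : ℝ) :
    tiltedMean W ((volume : Measure (Tor M → ℝ)).withDensity fun φ => ENNReal.ofReal (ρ φ)) s
      = (∫ φ : Tor M → ℝ, ρ φ * (W φ * Real.exp (s * W φ))) / ∫ φ : Tor M → ℝ, ρ φ * Real.exp (s * W φ) := by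
  have hν : ∀ f : (Tor M → ℝ) → ℝ, ∫ φ, f φ ∂((volume : Measure (Tor M → ℝ)).withDensity fun φ => ENNReal.ofReal (ρ φ))
      = ∫ φ : Tor M → ℝ, ρ φ * f φ := fun f => by
    rw [integral_withDensity_eq_integral_toReal_smul hρm.ennreal_ofReal (Eventually.of_forall fun φ => ENNReal.ofReal_lt_top)]
    refine integral_congr_ae (Eventually.of_forall fun φ => ?_)
    simp only [smul_eq_mul, ENNReal.toReal_ofReal (hρ0 φ)]
  unfold tiltedMean
  rw [integral_tilted, hν, hν, ← integral_div]
  refine integral_congr_ae (Eventually.of_forall fun φ => ?_)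
  simp only [smul_eq_mul]
  ring

end Dictionary

/-! ## §4 N14's binder `TiltedMeanMatching` for King's full-space Gaussian effective measures — no class cut -/
section King

open Literature.MathematicalPhysics.QuantumFieldTheory.King1986 (aK thetaK)
open Literature.MathematicalPhysics.QuantumFieldTheory.King1986.Torus (effLaplacian aminL)
open YMDAG.N18.KingModelDens (kingTheta_nonneg summable_kingRadius)
open YMDAG.N18.KingModelDensTorus (abs_action_sub_le_torus_of_eq)
open YMDAG.N18.KingModelLargeField (effLaplacian_coercive_unif gamma0_pos)

variable {l₀ B : ℝ} {W : (Tor M → ℝ) → ℝ}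

/-- **★★ THE TILTED-MEAN TWO-RUN BOUND AT KING'S OPERATORS** [folklore ∘ §2–§3 + n14-c's `abs_action_sub_le_torus`, `effLaplacian_coercive_unif`]: the `s`-tilted means of a bounded
measurable `W` under the full-space Gaussian effective measures of the runs `Δ^{(K+1)}`, `Δ^{(K+2)}` (presented, as the spine reads them, as `volume.withDensity e^{−½φ·Δφ}`) differ by at
most `B·e^{2|s|B}·θ_{K+1}·a·|Tor M|∕γ₀` — for EVERY tilt `s`, with NO small-field class. [cite: King1986, Prop 3.10 (3.91)–(3.92) p.669; (4.33)–(4.35) p.674] -/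
theorem abs_tiltedMean_sub_le_king {a : ℝ} (ha : 0 < a) {L : ℕ} [NeZero L] (hL : 2 ≤ L) {m2 : ℝ} (hm : 0 < m2) (hWm : Measurable W)
    (hWb : ∀ φ, |W φ| ≤ B) (K : ℕ) (s : ℝ) :
    |tiltedMean W ((volume : Measure (Tor M → ℝ)).withDensity fun φ => ENNReal.ofReal
          (Real.exp (-(φ ⬝ᵥ (effLaplacian (L ^ (K + 1 + 1)) M (aK a L (K + 1 + 1)) (((L ^ (K + 1 + 1) : ℕ) : ℝ) ^ 2) m2 *ᵥ φ) / 2)))) s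
        - tiltedMean W ((volume : Measure (Tor M → ℝ)).withDensity fun φ => ENNReal.ofReal
          (Real.exp (-(φ ⬝ᵥ (effLaplacian (L ^ (K + 1)) M (aK a L (K + 1)) (((L ^ (K + 1) : ℕ) : ℝ) ^ 2) m2 *ᵥ φ) / 2)))) s|
      ≤ B * Real.exp (2 * (|s| * B)) * (thetaK a L (K + 1) 1 * a) * Fintype.card (Tor M) / ((aminL a L)⁻¹ + m2⁻¹)⁻¹ := by
  rw [tiltedMean_withDensity_eq_div M
      (ρ := fun φ => Real.exp (-(φ ⬝ᵥ (effLaplacian (L ^ (K + 1 + 1)) M (aK a L (K + 1 + 1)) (((L ^ (K + 1 + 1) : ℕ) : ℝ) ^ 2) m2 *ᵥ φ) / 2)))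
      (Real.measurable_exp.comp ((measurable_dotProduct_mulVec M _).div_const 2).neg) (fun φ => (Real.exp_pos _).le),
    tiltedMean_withDensity_eq_div M
      (ρ := fun φ => Real.exp (-(φ ⬝ᵥ (effLaplacian (L ^ (K + 1)) M (aK a L (K + 1)) (((L ^ (K + 1) : ℕ) : ℝ) ^ 2) m2 *ᵥ φ) / 2)))
      (Real.measurable_exp.comp ((measurable_dotProduct_mulVec M _).div_const 2).neg) (fun φ => (Real.exp_pos _).le)]
  exact abs_tiltedRatio_sub_le_of_actionBound M (gamma0_pos ha hL hm) (mul_nonneg (kingTheta_nonneg ha hL (by omega) le_rfl) ha.le)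
    (effLaplacian_coercive_unif M ha hL (by omega) hm) (effLaplacian_coercive_unif M ha hL (by omega) hm)
    (fun φ => abs_action_sub_le_torus_of_eq M ha hL (k := K + 1) (n := 1) (by omega) le_rfl hm (L ^ (K + 1 + 1))
      (by rw [pow_one, pow_succ, mul_comm]) (K + 1 + 1) rfl φ)
    hWm hWb s

/-- **★★★ N14's BINDER `TiltedMeanMatching` INHABITED BY KING'S GAUSSIAN MODEL ON THE WHOLE FIELD SPACE** [folklore ∘ `abs_tiltedMean_sub_le_king`]: one class (`Unit`), `Bad = ∅`, run A =
`volume.withDensity e^{−½φ·Δ^{(K+1)}φ}`, run B = the same for `Δ^{(K+2)}`, the SAME bounded measurable observable `W` read on both, every source `|t| ≤ l₀` and every tilt `|s| ≤ l₀`: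
`TiltedMeanMatching l₀ univ ∅ W ν_A W ν_B (K ↦ B·e^{2l₀B}·θ_{K+1}·a·|Tor M|∕γ₀)`.  Compare n14-c's `tiltedMeanMatching_kingTorus_smallField` ∕ `tiltedMeanMatching_kingTwoClass` (DENS road,
small-field class of radius `R`, rate `B(e^{2r_K} − 1)` with `r_K ∝ R²`): on the FULL space the density ratio `e^{−½φ·(Δ_B−Δ_A)φ}` is unbounded, no DENS∕SHAPE sandwich exists, and the
annealed road is the one that lands the binder there. -/
theorem tiltedMeanMatching_kingFullSpace {a : ℝ} (ha : 0 < a) {L : ℕ} [NeZero L] (hL : 2 ≤ L) {m2 : ℝ} (hm : 0 < m2) (hWm : Measurable W)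
    (hWb : ∀ φ, |W φ| ≤ B) :
    TiltedMeanMatching (Ω := fun _ => Tor M → ℝ) (Ω' := fun _ => Tor M → ℝ) l₀ (fun _ => (Finset.univ : Finset Unit)) (fun _ _ => (∅ : Finset Unit))
      (fun _ => W)
      (fun K _ => (volume : Measure (Tor M → ℝ)).withDensity fun φ => ENNReal.ofReal
        (Real.exp (-(φ ⬝ᵥ (effLaplacian (L ^ (K + 1)) M (aK a L (K + 1)) (((L ^ (K + 1) : ℕ) : ℝ) ^ 2) m2 *ᵥ φ) / 2))))
      (fun _ => W)
      (fun K _ => (volume : Measure (Tor M → ℝ)).withDensity fun φ => ENNReal.ofReal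
        (Real.exp (-(φ ⬝ᵥ (effLaplacian (L ^ (K + 1 + 1)) M (aK a L (K + 1 + 1)) (((L ^ (K + 1 + 1) : ℕ) : ℝ) ^ 2) m2 *ᵥ φ) / 2))))
      fun K => B * Real.exp (2 * (l₀ * B)) * (thetaK a L (K + 1) 1 * a) * Fintype.card (Tor M) / ((aminL a L)⁻¹ + m2⁻¹)⁻¹ := by
  intro K t _ τ _ s hs
  have hγ := gamma0_pos ha hL hm
  have hB : 0 ≤ B := (abs_nonneg _).trans (hWb fun _ => 0)
  have hθ : 0 ≤ thetaK a L (K + 1) 1 * a := mul_nonneg (kingTheta_nonneg ha hL (by omega) le_rfl) ha.le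
  have hcard : (0 : ℝ) ≤ Fintype.card (Tor M) := Nat.cast_nonneg _
  have hexp : Real.exp (2 * (|s| * B)) ≤ Real.exp (2 * (l₀ * B)) := Real.exp_le_exp.2 (by nlinarith [abs_nonneg s])
  refine (abs_tiltedMean_sub_le_king M ha hL hm hWm hWb K s).trans ?_
  beta_reduce
  gcongr

/-- … with a SUMMABLE rate (geometric `θ_{K+1}`, n14-c's `summable_kingRadius`). [folklore] -/
theorem summable_eta_kingFullSpace {a : ℝ} (ha : 0 < a) {L : ℕ} (hL : 2 ≤ L) (m2 l₀ B : ℝ) :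
    Summable fun K : ℕ => B * Real.exp (2 * (l₀ * B)) * (thetaK a L (K + 1) 1 * a) * Fintype.card (Tor M) / ((aminL a L)⁻¹ + m2⁻¹)⁻¹ := by
  have h := ((summable_kingRadius ha hL (n := 1) le_rfl (M := (1 : ℝ)) zero_le_one 0).1.mul_left
    (2 * B * Real.exp (2 * (l₀ * B)) * Fintype.card (Tor M) / ((aminL a L)⁻¹ + m2⁻¹)⁻¹))
  refine h.congr fun K => ?_
  ring

end King

end Summit.QuantumFields.YangMills.BalabanUVNodes.N19TiltPathTilted

end
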